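/-
Copyright (c) 2026 the pub-hodgecm-mathlib formalisation cell (harness21).  Prover seat hodgecm-mathlib-A-p12 (g25), 2026-09-02.  «S3-ram» (LEAD F0P3a-plan (g13); owner p06;
(Cnt2′) chair F0P3a-p07 (g15) RULING (13)): the W-SIDE CENTRE of a type-(2) block — the conjugator wanted by (h1) «J2-FRAME-hyp» (A-p19 (g29) 04:17:29Z «WANT»).
`--supports stmt-HodgeConjecture-24833`.
-/
import Literature.NumberTheory.Rogawski1990.DepthZeroKappaTransferTypeTwoRamifiedWSideBalls   -- ★ p848780 (this lineage, g24): centred balls in lattice currency, odd-scale collapse; brings ★ (B-i) I–IV, ★ p848486 rank-2 transitivity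
import Literature.NumberTheory.Automorphic.UnitaryLatticeTreeRegionGrandchildLabelsOfRootRamified   -- ★ `scaleLattice_pow_le_of_le` (F0P2-p02)
import HarnessLib

/-!
# The W-side CENTRE of a 2-deep type-(2) block at a tame-ramified place: a unitary conjugate `k⁻¹Γk` whose traceless part has the maximal depth `D_E` at `𝒪_w²`, EXACTLY
# (Labesse–Langlands 1979 §2 Lemma 2.1; Rogawski 1990 §4.9; Kottwitz 1986 §3)

Topic `NumberTheory/Rogawski1990`; namespace `Literature.NumberTheory.Automorphic.UnitaryGroup`.  THEOREMS ONLY (no definition, no instance, no notation, no named fact, no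
`sorry`); kernel lane `--supports stmt-HodgeConjecture-24833`; cell `pub/hodgecm-mathlib` (D-0151), crux H413, road «S3-ram» (count-neutral); seat A-p12 (g25), (Cnt2′)
ROUTE B: the input «centring conjugator» of (h1) «J2-FRAME-hyp» (A-p19 (g29)), by which the hyperbolic literal `ι(ĝ_w, û_w)` is re-rooted at the CENTRE of the fixed ball of its
W-block before the raw junction head ★ `strataCount_J₀_of_charpoly_block_raw` is applied (root depth `d₀ = min(D_E, v_w(½tr ĝ_w − û_w))`, chair `stub_mdict`).
HONEST LABEL: HC_CM is proved only modulo the 2 remaining named inputs (hLiu418 24832, h413 24833) until rung 0 closes; nothing printed is asserted here.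

THE MATHEMATICS.  `γ₂ ∈ U₂(L⁺_v)` of type (2) at `w` (`Γ = E₂γ₂ ∈ U(σ_w, Φ₂)`, 2-deep, `χ_Γ` rootless, `|tr²Γ − 4detΓ|_w = exp(−2N)`), `E := Γ − ½trΓ·1` (traceless, `E² = ¼(tr² − 4det)·1`).
The centred depth balls `{B ∣ SD, ΓB = B, E·B ⊆ ϖ^{2j}B}` have `(q+1)·Σ_(k<n−j) q^k` members for `N = 2n`, `j < n` (★ (B-i) II, lattice currency ★ p848780) and `2·Σ_(k≤n−j) q^k − 1`
for `N = 2n+1`, `j ≤ n` (★ III); in particular the innermost ball (`j = n−1`, resp. `j = n`) is NON-EMPTY (`q+1`, resp. `1` members).  Pick `B` in it; by ★ rank-2 transitivity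
(p848486) `B = k·𝒪_w²` with `k ∈ U(σ_w, Φ₂)`, and the token reads `|(k⁻¹Γk − ½trΓ·1)_{ab}| ≤ |ϖ|^{2j}` (★ `map_toLin'_mapGL_stdLattice_le_scaleLattice_iff`); the ODD-SCALE
COLLAPSE (★ `selfDual_fixed_ball_odd_scale_eq`, `N ≠ 2j`) upgrades `2j` to `2j+1`.  Hence **`|(k⁻¹Γk − ½trΓ·1)_{ab}| ≤ |ϖ|^{D_E}`, `D_E = 2n−1` (`N = 2n`) ∕ `2n+1 = N`
(`N = 2n+1`)**, and EXACTLY: for `N = 2n` the top ball `j = n` is EMPTY (★ IV, p847580), so not all entries are `≤ |ϖ|^{2n}`; for `N = 2n+1`, `E_k² = ¼disc·1` with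
`|¼disc| = |ϖ|^{2N}` forbids all entries `≤ |ϖ|^{N+1}`.  So `𝒪_w²` is the CENTRE of the fixed ball of `k⁻¹Γk` (the unique deepest vertex for odd `N`; one of the `q+1` deepest
self-dual vertices around the modular centre for even `N`).

* `exists_unitary_conj_sub_half_trace_le_centre_of_even_depth_ramified` (`N = 2n ≥ 2`): `∃ k ∈ U(σ_w,Φ₂,w)`, entries `≤ |ϖ|^(2n−1)`, not all `≤ |ϖ|^(2n)`.
* `exists_unitary_conj_sub_half_trace_le_centre_of_odd_depth_ramified` (`N = 2n+1`): `∃ k ∈ U(σ_w,Φ₂,w)`, entries `≤ |ϖ|^(2n+1)`, not all `≤ |ϖ|^(2n+2)`.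
Consumers: A-p19 (g29) (h1) `TypeTwoRamifiedFrameLiteralCentred` (binder `hk`), F0P3a-p08 (g20) `stub_Zhyp_*`.

## References
* [LabesseLanglands1979] J.-P. Labesse, R. P. Langlands, *L-indistinguishability for SL(2)*, Canad. J. Math. 31 (1979): §2 Lemma 2.1 p. 8 (fixed balls of elliptic tori).
* [Rogawski1990] J. D. Rogawski, *Automorphic Representations of Unitary Groups in Three Variables* (1990): §4.9 pp. 54–56, Lemma 4.9.3.
* [Kottwitz1986] R. Kottwitz, *Base change for unit elements of Hecke algebras*, Compositio Math. 60 (1986): §3.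
-/

set_option autoImplicit false

noncomputable section

open MeasureTheory Measure Set NumberField IsDedekindDomain Matrix ValuativeRel MulAction Finset Polynomial
open scoped ValuativeRel Matrix MatrixGroups WithZero

namespace Literature.NumberTheory.Automorphic.UnitaryGroup

open Literature.NumberTheory.Rogawski1990 Literature.NumberTheory.Automorphic Literature.NumberTheory.Automorphic.IntegralReduction
open Literature.NumberTheory.Automorphic.UnitaryLatticeTree Literature.NumberTheory.Automorphic.HermitianLattice Literature.GroupTheory Literature.NumberTheory.GaloisRepresentations

section Centre

variable (L : Type) [Field L] [NumberField L] [IsCMField L] (v : HeightOneSpectrum (𝓞 ↥(maximalRealSubfield L)))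
  (w : PlacesOver L v) (hw : IsCMField.complexConj L • w.1 = w.1)

set_option maxHeartbeats 1600000 in
include hw in
/-- **THE W-SIDE CENTRE, EVEN DISCRIMINANT DEPTH `N = 2n` (`n ≥ 1`).**  For a type-(2) `γ₂ ∈ U₂(L⁺_v)` 2-deep at `w` with `|tr² − 4det|_w(Γ) = exp(−2·2n)` (`Γ = E₂γ₂`) there is
`k ∈ U(σ_w, Φ₂,w)` with **`|(k⁻¹Γk − ½trΓ·1)_{ab}|_w ≤ |ϖ|^(2n−1)` for all `a b`, and NOT all `≤ |ϖ|^(2n)`** — `𝒪_w²` is a deepest self-dual vertex of the fixed ball of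
`k⁻¹Γk` (one of the `q+1` around the modular centre).  ★ (B-i) II at `j = n−1` (non-empty) + ★ odd-scale collapse + ★ rank-2 transitivity; exactness by ★ IV (the top ball is
empty). [cite: LabesseLanglands1979, §2 Lemma 2.1 p. 8] [cite: Rogawski1990, §4.9 Lemma 4.9.3 p. 56] -/
theorem exists_unitary_conj_sub_half_trace_le_centre_of_even_depth_ramified (he : v.asIdeal.ramificationIdx' w.1.asIdeal ≠ 1) (h2 : IsUnit (2 : 𝒪[(w.1.adicCompletion L)]))
    (ϖ : (w.1.adicCompletion L)ˣ) (hϖ : Valued.v (ϖ : (w.1.adicCompletion L)) = WithZero.exp (-1 : ℤ))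
    (hσϖ : (galAdicCompletionMap (L := L) (IsCMField.complexConj L) hw) (ϖ : (w.1.adicCompletion L)) = -(ϖ : (w.1.adicCompletion L))) (γ₂ : ((cmDatum L 2 (Matrix.of fun i j : Fin 2 => if i.val + j.val + 1 = 2 then (1 : L) else 0)).Local v))
    (hirr : ¬ ∃ x : (w.1.adicCompletion L), ((((((localNonsplitEquiv (IsCMField.complexConj L) (Matrix.of fun i j : Fin 2 => if i.val + j.val + 1 = 2 then (1 : L) else 0) (IsCMField.complexConj_ne_one L) w hw) (γ₂) : ↥(unitaryGroupOfForm (galAdicCompletionMap (L := L) (IsCMField.complexConj L) hw) (placeForm (Matrix.of fun i j : Fin 2 => if i.val + j.val + 1 = 2 then (1 : L) else 0) w.1))) : GL (Fin 2) (w.1.adicCompletion L))) : Matrix (Fin 2) (Fin 2) (w.1.adicCompletion L)).charpoly).IsRoot x)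
    (h2deep : ∀ i j : Fin 2, Valued.v (((((((localNonsplitEquiv (IsCMField.complexConj L) (Matrix.of fun i j : Fin 2 => if i.val + j.val + 1 = 2 then (1 : L) else 0) (IsCMField.complexConj_ne_one L) w hw) (γ₂) : ↥(unitaryGroupOfForm (galAdicCompletionMap (L := L) (IsCMField.complexConj L) hw) (placeForm (Matrix.of fun i j : Fin 2 => if i.val + j.val + 1 = 2 then (1 : L) else 0) w.1))) : GL (Fin 2) (w.1.adicCompletion L))) : Matrix (Fin 2) (Fin 2) (w.1.adicCompletion L)) - 1) i j) ≤ Valued.v ((ϖ : (w.1.adicCompletion L)) ^ 2))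
    {n : ℕ} (hn1 : 1 ≤ n) (hN : Valued.v ((((((localNonsplitEquiv (IsCMField.complexConj L) (Matrix.of fun i j : Fin 2 => if i.val + j.val + 1 = 2 then (1 : L) else 0) (IsCMField.complexConj_ne_one L) w hw) (γ₂) : ↥(unitaryGroupOfForm (galAdicCompletionMap (L := L) (IsCMField.complexConj L) hw) (placeForm (Matrix.of fun i j : Fin 2 => if i.val + j.val + 1 = 2 then (1 : L) else 0) w.1))) : GL (Fin 2) (w.1.adicCompletion L))) : Matrix (Fin 2) (Fin 2) (w.1.adicCompletion L)).trace ^ 2 - 4 * (((((localNonsplitEquiv (IsCMField.complexConj L) (Matrix.of fun i j : Fin 2 => if i.val + j.val + 1 = 2 then (1 : L) else 0) (IsCMField.complexConj_ne_one L) w hw) (γ₂) : ↥(unitaryGroupOfForm (galAdicCompletionMap (L := L) (IsCMField.complexConj L) hw) (placeForm (Matrix.of fun i j : Fin 2 => if i.val + j.val + 1 = 2 then (1 : L) else 0) w.1))) : GL (Fin 2) (w.1.adicCompletion L))) : Matrix (Fin 2) (Fin 2) (w.1.adicCompletion L)).det) = WithZero.exp (-((2 * (2 * n) : ℕ) : ℤ)))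 :
    ∃ k : GL (Fin 2) (w.1.adicCompletion L), k ∈ unitaryGroupOfForm (galAdicCompletionMap (L := L) (IsCMField.complexConj L) hw) (placeForm (Matrix.of fun i j : Fin 2 => if i.val + j.val + 1 = 2 then (1 : L) else 0) w.1) ∧
      (∀ a b : Fin 2, Valued.v ((((k⁻¹ * ((((localNonsplitEquiv (IsCMField.complexConj L) (Matrix.of fun i j : Fin 2 => if i.val + j.val + 1 = 2 then (1 : L) else 0) (IsCMField.complexConj_ne_one L) w hw) (γ₂) : ↥(unitaryGroupOfForm (galAdicCompletionMap (L := L) (IsCMField.complexConj L) hw) (placeForm (Matrix.of fun i j : Fin 2 => if i.val + j.val + 1 = 2 then (1 : L) else 0) w.1))) : GL (Fin 2) (w.1.adicCompletion L))) * k : GL (Fin 2) (w.1.adicCompletion L)) : Matrix (Fin 2) (Fin 2) (w.1.adicCompletion L)) - ((((((localNonsplitEquiv (IsCMField.complexConj L) (Matrix.of fun i j : Fin 2 => if i.val + j.val + 1 = 2 then (1 : L) else 0) (IsCMField.complexConj_ne_one L) w hw) (γ₂) : ↥(unitaryGroupOfForm (galAdicCompletionMap (L := L) (IsCMField.complexConj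 L) hw) (placeForm (Matrix.of fun i j : Fin 2 => if i.val + j.val + 1 = 2 then (1 : L) else 0) w.1))) : GL (Fin 2) (w.1.adicCompletion L))) : Matrix (Fin 2) (Fin 2) (w.1.adicCompletion L)).trace / 2) • (1 : Matrix (Fin 2) (Fin 2) (w.1.adicCompletion L))) a b) ≤ Valued.v ((ϖ : (w.1.adicCompletion L)) ^ (2 * n - 1))) ∧
      ¬ (∀ a b : Fin 2, Valued.v ((((k⁻¹ * ((((localNonsplitEquiv (IsCMField.complexConj L) (Matrix.of fun i j : Fin 2 => if i.val + j.val + 1 = 2 then (1 : L) else 0) (IsCMField.complexConj_ne_one L) w hw) (γ₂) : ↥(unitaryGroupOfForm (galAdicCompletionMap (L := L) (IsCMField.complexConj L) hw) (placeForm (Matrix.of fun i j : Fin 2 => if i.val + j.val + 1 = 2 then (1 : L) else 0) w.1))) : GL (Fin 2) (w.1.adicCompletion L))) * k : GL (Fin 2) (w.1.adicCompletion L)) : Matrix (Fin 2) (Fin 2) (w.1.adicCompletion L)) - ((((((localNonsplitEquiv (IsCMField.complexConj L) (Matrix.of fun i j : Fin 2 => if i.val + j.val + 1 = 2 then (1 :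 L) else 0) (IsCMField.complexConj_ne_one L) w hw) (γ₂) : ↥(unitaryGroupOfForm (galAdicCompletionMap (L := L) (IsCMField.complexConj L) hw) (placeForm (Matrix.of fun i j : Fin 2 => if i.val + j.val + 1 = 2 then (1 : L) else 0) w.1))) : GL (Fin 2) (w.1.adicCompletion L))) : Matrix (Fin 2) (Fin 2) (w.1.adicCompletion L)).trace / 2) • (1 : Matrix (Fin 2) (Fin 2) (w.1.adicCompletion L))) a b) ≤ Valued.v ((ϖ : (w.1.adicCompletion L)) ^ (2 * n))) := by
  have hϖ0 : (ϖ : (w.1.adicCompletion L)) ≠ 0 := ϖ.ne_zero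
  have hϖ1 : Valued.v (ϖ : (w.1.adicCompletion L)) ≤ 1 := by rw [hϖ, ← WithZero.exp_zero]; exact WithZero.exp_le_exp.2 (by norm_num)
  have hΓU : ((((localNonsplitEquiv (IsCMField.complexConj L) (Matrix.of fun i j : Fin 2 => if i.val + j.val + 1 = 2 then (1 : L) else 0) (IsCMField.complexConj_ne_one L) w hw) (γ₂) : ↥(unitaryGroupOfForm (galAdicCompletionMap (L := L) (IsCMField.complexConj L) hw) (placeForm (Matrix.of fun i j : Fin 2 => if i.val + j.val + 1 = 2 then (1 : L) else 0) w.1))) : GL (Fin 2) (w.1.adicCompletion L))) ∈ unitaryGroupOfForm (galAdicCompletionMap (L := L) (IsCMField.complexConj L) hw) (placeForm (Matrix.of fun i j : Fin 2 => if i.val + j.val + 1 = 2 then (1 : L) else 0) w.1) := ((localNonsplitEquiv (IsCMField.complexConj L) (Matrix.of fun i j : Fin 2 => if i.val + j.val + 1 = 2 then (1 : L) else 0) (IsCMField.complexConj_ne_one L) w hw) (γ₂)).2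
  -- the innermost ball `j = n − 1` has `q + 1` members: it is non-empty (and finite)
  have hcard := ncard_selfDual_fixed_ball_of_even_depth_ramified L v w hw he h2 ϖ hϖ hσϖ γ₂ hirr h2deep hN (j := n - 1) (by omega)
  rw [show n - (n - 1) = 1 by omega, Finset.sum_range_one, pow_zero, mul_one] at hcard
  have hne : ({B : Submodule (Valued.integer (w.1.adicCompletion L)) (Fin 2 → (w.1.adicCompletion L)) | UnitaryLatticeTree.IsSelfDualLattice (galAdicCompletionMap (L := L) (IsCMField.complexConj L) hw) (ϖ : (w.1.adicCompletion L)) (!![(0 : (w.1.adicCompletion L)), 1; 1, 0] : Matrix (Fin 2) (Fin 2) (w.1.adicCompletion L)) B ∧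
        UnitaryLatticeTree.mapGL ((((localNonsplitEquiv (IsCMField.complexConj L) (Matrix.of fun i j : Fin 2 => if i.val + j.val + 1 = 2 then (1 : L) else 0) (IsCMField.complexConj_ne_one L) w hw) (γ₂) : ↥(unitaryGroupOfForm (galAdicCompletionMap (L := L) (IsCMField.complexConj L) hw) (placeForm (Matrix.of fun i j : Fin 2 => if i.val + j.val + 1 = 2 then (1 : L) else 0) w.1))) : GL (Fin 2) (w.1.adicCompletion L))) B = B ∧
        B.map ((Matrix.toLin' ((((((localNonsplitEquiv (IsCMField.complexConj L) (Matrix.of fun i j : Fin 2 => if i.val + j.val + 1 = 2 then (1 : L) else 0) (IsCMField.complexConj_ne_one L) w hw) (γ₂) : ↥(unitaryGroupOfForm (galAdicCompletionMap (L := L) (IsCMField.complexConj L) hw) (placeForm (Matrix.of fun i j : Fin 2 => if i.val + j.val + 1 = 2 then (1 : L) else 0) w.1))) : GL (Fin 2) (w.1.adicCompletion L))) : Matrix (Fin 2) (Fin 2) (w.1.adicCompletion L)) - ((((((localNonsplitEquiv (IsCMField.complexConj L) (Matrix.of fun i j : Fin 2 => if i.val + j.val + 1 = 2 then (1 : L)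 else 0) (IsCMField.complexConj_ne_one L) w hw) (γ₂) : ↥(unitaryGroupOfForm (galAdicCompletionMap (L := L) (IsCMField.complexConj L) hw) (placeForm (Matrix.of fun i j : Fin 2 => if i.val + j.val + 1 = 2 then (1 : L) else 0) w.1))) : GL (Fin 2) (w.1.adicCompletion L))) : Matrix (Fin 2) (Fin 2) (w.1.adicCompletion L)).trace / 2) • (1 : Matrix (Fin 2) (Fin 2) (w.1.adicCompletion L)))).restrictScalars (Valued.integer (w.1.adicCompletion L))) ≤ UnitaryLatticeTree.scaleLattice ((ϖ : (w.1.adicCompletion L)) ^ (2 * (n - 1))) B}).ncard ≠ 0 := by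
    rw [hcard]; exact Nat.succ_ne_zero _
  have hfin := Set.finite_of_ncard_ne_zero hne
  obtain ⟨B, hB⟩ := Set.nonempty_of_ncard_ne_zero hne
  -- odd-scale collapse: `B` is in the ball of scale `ϖ^(2(n−1)+1)`
  have hB' : B ∈ {B : Submodule (Valued.integer (w.1.adicCompletion L)) (Fin 2 → (w.1.adicCompletion L)) | UnitaryLatticeTree.IsSelfDualLattice (galAdicCompletionMap (L := L) (IsCMField.complexConj L) hw) (ϖ : (w.1.adicCompletion L)) (!![(0 : (w.1.adicCompletion L)), 1; 1, 0] : Matrix (Fin 2) (Fin 2) (w.1.adicCompletion L)) B ∧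
        UnitaryLatticeTree.mapGL ((((localNonsplitEquiv (IsCMField.complexConj L) (Matrix.of fun i j : Fin 2 => if i.val + j.val + 1 = 2 then (1 : L) else 0) (IsCMField.complexConj_ne_one L) w hw) (γ₂) : ↥(unitaryGroupOfForm (galAdicCompletionMap (L := L) (IsCMField.complexConj L) hw) (placeForm (Matrix.of fun i j : Fin 2 => if i.val + j.val + 1 = 2 then (1 : L) else 0) w.1))) : GL (Fin 2) (w.1.adicCompletion L))) B = B ∧
        B.map ((Matrix.toLin' ((((((localNonsplitEquiv (IsCMField.complexConj L) (Matrix.of fun i j : Fin 2 => if i.val + j.val + 1 = 2 then (1 : L) else 0) (IsCMField.complexConj_ne_one L) w hw) (γ₂) : ↥(unitaryGroupOfForm (galAdicCompletionMap (L := L) (IsCMField.complexConj L) hw) (placeForm (Matrix.of fun i j : Fin 2 => if i.val + j.val + 1 = 2 then (1 : L) else 0) w.1))) : GL (Fin 2) (w.1.adicCompletion L))) : Matrix (Fin 2) (Fin 2) (w.1.adicCompletion L)) - ((((((localNonsplitEquiv (IsCMField.complexConj L) (Matrix.of fun i j : Fin 2 => if i.val + j.val + 1 = 2 then (1 : L)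 else 0) (IsCMField.complexConj_ne_one L) w hw) (γ₂) : ↥(unitaryGroupOfForm (galAdicCompletionMap (L := L) (IsCMField.complexConj L) hw) (placeForm (Matrix.of fun i j : Fin 2 => if i.val + j.val + 1 = 2 then (1 : L) else 0) w.1))) : GL (Fin 2) (w.1.adicCompletion L))) : Matrix (Fin 2) (Fin 2) (w.1.adicCompletion L)).trace / 2) • (1 : Matrix (Fin 2) (Fin 2) (w.1.adicCompletion L)))).restrictScalars (Valued.integer (w.1.adicCompletion L))) ≤ UnitaryLatticeTree.scaleLattice ((ϖ : (w.1.adicCompletion L)) ^ (2 * (n - 1) + 1)) B} := by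
    rw [selfDual_fixed_ball_odd_scale_eq L v w hw he h2 ϖ hϖ hσϖ ((((localNonsplitEquiv (IsCMField.complexConj L) (Matrix.of fun i j : Fin 2 => if i.val + j.val + 1 = 2 then (1 : L) else 0) (IsCMField.complexConj_ne_one L) w hw) (γ₂) : ↥(unitaryGroupOfForm (galAdicCompletionMap (L := L) (IsCMField.complexConj L) hw) (placeForm (Matrix.of fun i j : Fin 2 => if i.val + j.val + 1 = 2 then (1 : L) else 0) w.1))) : GL (Fin 2) (w.1.adicCompletion L))) hΓU h2deep hN (j := n - 1) (by omega)]; exact hB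
  obtain ⟨hsd, hfix, hle⟩ := hB'
  -- `B = k·𝒪_w²` with `k` unitary (★ rank-2 transitivity), and the token reads on the entries of `k⁻¹Γk − c·1`
  obtain ⟨u, hu⟩ := exists_unitary_mapGL_stdLattice_eq_of_isSelfDualLattice_two L v w hw he h2 B hsd
  rw [hu, map_toLin'_mapGL_stdLattice_le_scaleLattice_iff (pow_ne_zero _ hϖ0), conj_sub_smul_one_eq] at hle
  refine ⟨(u : GL (Fin 2) (w.1.adicCompletion L)), ?_, fun a b => ?_, fun hall => ?_⟩
  · rw [unitaryGroupOfForm_placeForm_antidiagTwo_eq]; exact u.2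
  · have h := hle a b
    rwa [show 2 * (n - 1) + 1 = 2 * n - 1 by omega] at h
  · -- the top ball `j = n` is EMPTY (★ IV): `B` cannot be in it
    have htop := ncard_selfDual_fixed_ball_top_of_even_depth_ramified L v w hw he h2 ϖ hϖ hσϖ γ₂ hirr h2deep hn1 hN
    have hBtop : B ∈ {B : Submodule (Valued.integer (w.1.adicCompletion L)) (Fin 2 → (w.1.adicCompletion L)) | UnitaryLatticeTree.IsSelfDualLattice (galAdicCompletionMap (L := L) (IsCMField.complexConj L) hw) (ϖ : (w.1.adicCompletion L)) (!![(0 : (w.1.adicCompletion L)), 1; 1, 0] : Matrix (Fin 2) (Fin 2) (w.1.adicCompletion L)) B ∧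
        UnitaryLatticeTree.mapGL ((((localNonsplitEquiv (IsCMField.complexConj L) (Matrix.of fun i j : Fin 2 => if i.val + j.val + 1 = 2 then (1 : L) else 0) (IsCMField.complexConj_ne_one L) w hw) (γ₂) : ↥(unitaryGroupOfForm (galAdicCompletionMap (L := L) (IsCMField.complexConj L) hw) (placeForm (Matrix.of fun i j : Fin 2 => if i.val + j.val + 1 = 2 then (1 : L) else 0) w.1))) : GL (Fin 2) (w.1.adicCompletion L))) B = B ∧
        B.map ((Matrix.toLin' ((((((localNonsplitEquiv (IsCMField.complexConj L) (Matrix.of fun i j : Fin 2 => if i.val + j.val + 1 = 2 then (1 : L) else 0) (IsCMField.complexConj_ne_one L) w hw) (γ₂) : ↥(unitaryGroupOfForm (galAdicCompletionMap (L := L) (IsCMField.complexConj L) hw) (placeForm (Matrix.of fun i j : Fin 2 => if i.val + j.val + 1 = 2 then (1 : L) else 0) w.1))) : GL (Fin 2) (w.1.adicCompletion L))) : Matrix (Fin 2) (Fin 2) (w.1.adicCompletion L)) - ((((((localNonsplitEquiv (IsCMField.complexConj L) (Matrix.of fun i j : Fin 2 => if i.val + j.val + 1 = 2 then (1 : L)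 else 0) (IsCMField.complexConj_ne_one L) w hw) (γ₂) : ↥(unitaryGroupOfForm (galAdicCompletionMap (L := L) (IsCMField.complexConj L) hw) (placeForm (Matrix.of fun i j : Fin 2 => if i.val + j.val + 1 = 2 then (1 : L) else 0) w.1))) : GL (Fin 2) (w.1.adicCompletion L))) : Matrix (Fin 2) (Fin 2) (w.1.adicCompletion L)).trace / 2) • (1 : Matrix (Fin 2) (Fin 2) (w.1.adicCompletion L)))).restrictScalars (Valued.integer (w.1.adicCompletion L))) ≤ UnitaryLatticeTree.scaleLattice ((ϖ : (w.1.adicCompletion L)) ^ (2 * n)) B} := by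
      refine ⟨hsd, hfix, ?_⟩
      rw [hu, map_toLin'_mapGL_stdLattice_le_scaleLattice_iff (pow_ne_zero _ hϖ0), conj_sub_smul_one_eq]
      exact hall
    have hsub : {B : Submodule (Valued.integer (w.1.adicCompletion L)) (Fin 2 → (w.1.adicCompletion L)) | UnitaryLatticeTree.IsSelfDualLattice (galAdicCompletionMap (L := L) (IsCMField.complexConj L) hw) (ϖ : (w.1.adicCompletion L)) (!![(0 : (w.1.adicCompletion L)), 1; 1, 0] : Matrix (Fin 2) (Fin 2) (w.1.adicCompletion L)) B ∧
        UnitaryLatticeTree.mapGL ((((localNonsplitEquiv (IsCMField.complexConj L) (Matrix.of fun i j : Fin 2 => if i.val + j.val + 1 = 2 then (1 : L) else 0) (IsCMField.complexConj_ne_one L) w hw) (γ₂) : ↥(unitaryGroupOfForm (galAdicCompletionMap (L := L) (IsCMField.complexConj L) hw) (placeForm (Matrix.of fun i j : Fin 2 => if i.val + j.val + 1 = 2 then (1 : L) else 0) w.1))) : GL (Fin 2) (w.1.adicCompletion L))) B = B ∧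
        B.map ((Matrix.toLin' ((((((localNonsplitEquiv (IsCMField.complexConj L) (Matrix.of fun i j : Fin 2 => if i.val + j.val + 1 = 2 then (1 : L) else 0) (IsCMField.complexConj_ne_one L) w hw) (γ₂) : ↥(unitaryGroupOfForm (galAdicCompletionMap (L := L) (IsCMField.complexConj L) hw) (placeForm (Matrix.of fun i j : Fin 2 => if i.val + j.val + 1 = 2 then (1 : L) else 0) w.1))) : GL (Fin 2) (w.1.adicCompletion L))) : Matrix (Fin 2) (Fin 2) (w.1.adicCompletion L)) - ((((((localNonsplitEquiv (IsCMField.complexConj L) (Matrix.of fun i j : Fin 2 => if i.val + j.val + 1 = 2 then (1 : L) else 0) (IsCMField.complexConj_ne_one L) w hw) (γ₂) : ↥(unitaryGroupOfForm (galAdicCompletionMap (L := L) (IsCMField.complexConj L) hw) (placeForm (Matrix.of fun i j : Fin 2 => if i.val + j.val + 1 = 2 then (1 : L) else 0) w.1))) : GL (Fin 2) (w.1.adicCompletion L))) : Matrix (Fin 2) (Fin 2) (w.1.adicCompletion L)).trace / 2) • (1 : Matrix (Fin 2) (Fin 2) (w.1.adicCompletion L)))).restrictScalars (Valued.integer (w.1.adicCompletion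 L))) ≤ UnitaryLatticeTree.scaleLattice ((ϖ : (w.1.adicCompletion L)) ^ (2 * n)) B} ⊆ {B : Submodule (Valued.integer (w.1.adicCompletion L)) (Fin 2 → (w.1.adicCompletion L)) | UnitaryLatticeTree.IsSelfDualLattice (galAdicCompletionMap (L := L) (IsCMField.complexConj L) hw) (ϖ : (w.1.adicCompletion L)) (!![(0 : (w.1.adicCompletion L)), 1; 1, 0] : Matrix (Fin 2) (Fin 2) (w.1.adicCompletion L)) B ∧
        UnitaryLatticeTree.mapGL ((((localNonsplitEquiv (IsCMField.complexConj L) (Matrix.of fun i j : Fin 2 => if i.val + j.val + 1 = 2 then (1 : L) else 0) (IsCMField.complexConj_ne_one L) w hw) (γ₂) : ↥(unitaryGroupOfForm (galAdicCompletionMap (L := L) (IsCMField.complexConj L) hw) (placeForm (Matrix.of fun i j : Fin 2 => if i.val + j.val + 1 = 2 then (1 : L) else 0) w.1))) : GL (Fin 2) (w.1.adicCompletion L))) B = B ∧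
        B.map ((Matrix.toLin' ((((((localNonsplitEquiv (IsCMField.complexConj L) (Matrix.of fun i j : Fin 2 => if i.val + j.val + 1 = 2 then (1 : L) else 0) (IsCMField.complexConj_ne_one L) w hw) (γ₂) : ↥(unitaryGroupOfForm (galAdicCompletionMap (L := L) (IsCMField.complexConj L) hw) (placeForm (Matrix.of fun i j : Fin 2 => if i.val + j.val + 1 = 2 then (1 : L) else 0) w.1))) : GL (Fin 2) (w.1.adicCompletion L))) : Matrix (Fin 2) (Fin 2) (w.1.adicCompletion L)) - ((((((localNonsplitEquiv (IsCMField.complexConj L) (Matrix.of fun i j : Fin 2 => if i.val + j.val + 1 = 2 then (1 : L) else 0) (IsCMField.complexConj_ne_one L) w hw) (γ₂) : ↥(unitaryGroupOfForm (galAdicCompletionMap (L := L) (IsCMField.complexConj L) hw) (placeForm (Matrix.of fun i j : Fin 2 => if i.val + j.val + 1 = 2 then (1 : L) else 0) w.1))) : GL (Fin 2) (w.1.adicCompletion L))) : Matrix (Fin 2) (Fin 2) (w.1.adicCompletion L)).trace / 2) • (1 : Matrix (Fin 2) (Fin 2) (w.1.adicCompletion L)))).restrictScalars (Valued.integer (w.1.adicCompletion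 L))) ≤ UnitaryLatticeTree.scaleLattice ((ϖ : (w.1.adicCompletion L)) ^ (2 * (n - 1))) B} := by
      rintro B' ⟨h1, h2', h3⟩
      exact ⟨h1, h2', h3.trans (scaleLattice_pow_le_of_le hϖ1 B' (by omega))⟩
    have hempty := (Set.ncard_eq_zero (hfin.subset hsub)).1 htop
    rw [hempty] at hBtop
    exact hBtop

set_option maxHeartbeats 1600000 in
include hw in
/-- **THE W-SIDE CENTRE, ODD DISCRIMINANT DEPTH `N = 2n+1`.**  For a type-(2) `γ₂ ∈ U₂(L⁺_v)` 2-deep at `w` with `|tr² − 4det|_w(Γ) = exp(−2·(2n+1))` (`Γ = E₂γ₂`) there is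
`k ∈ U(σ_w, Φ₂,w)` with **`|(k⁻¹Γk − ½trΓ·1)_{ab}|_w ≤ |ϖ|^(2n+1)` for all `a b`, and NOT all `≤ |ϖ|^(2n+2)`** — `𝒪_w²` is THE deepest self-dual vertex (the centre) of the fixed
ball of `k⁻¹Γk`.  ★ (B-i) III at `j = n` (one member) + ★ odd-scale collapse + ★ rank-2 transitivity; exactness by `E² = ¼(tr² − 4det)·1` (`|¼disc| = |ϖ|^(2N)`).
[cite: LabesseLanglands1979, §2 Lemma 2.1 p. 8] [cite: Rogawski1990, §4.9 Lemma 4.9.3 p. 56] -/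
theorem exists_unitary_conj_sub_half_trace_le_centre_of_odd_depth_ramified (he : v.asIdeal.ramificationIdx' w.1.asIdeal ≠ 1) (h2 : IsUnit (2 : 𝒪[(w.1.adicCompletion L)]))
    (ϖ : (w.1.adicCompletion L)ˣ) (hϖ : Valued.v (ϖ : (w.1.adicCompletion L)) = WithZero.exp (-1 : ℤ))
    (hσϖ : (galAdicCompletionMap (L := L) (IsCMField.complexConj L) hw) (ϖ : (w.1.adicCompletion L)) = -(ϖ : (w.1.adicCompletion L))) (γ₂ : ((cmDatum L 2 (Matrix.of fun i j : Fin 2 => if i.val + j.val + 1 = 2 then (1 : L) else 0)).Local v))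
    (hirr : ¬ ∃ x : (w.1.adicCompletion L), ((((((localNonsplitEquiv (IsCMField.complexConj L) (Matrix.of fun i j : Fin 2 => if i.val + j.val + 1 = 2 then (1 : L) else 0) (IsCMField.complexConj_ne_one L) w hw) (γ₂) : ↥(unitaryGroupOfForm (galAdicCompletionMap (L := L) (IsCMField.complexConj L) hw) (placeForm (Matrix.of fun i j : Fin 2 => if i.val + j.val + 1 = 2 then (1 : L) else 0) w.1))) : GL (Fin 2) (w.1.adicCompletion L))) : Matrix (Fin 2) (Fin 2) (w.1.adicCompletion L)).charpoly).IsRoot x)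
    (h2deep : ∀ i j : Fin 2, Valued.v (((((((localNonsplitEquiv (IsCMField.complexConj L) (Matrix.of fun i j : Fin 2 => if i.val + j.val + 1 = 2 then (1 : L) else 0) (IsCMField.complexConj_ne_one L) w hw) (γ₂) : ↥(unitaryGroupOfForm (galAdicCompletionMap (L := L) (IsCMField.complexConj L) hw) (placeForm (Matrix.of fun i j : Fin 2 => if i.val + j.val + 1 = 2 then (1 : L) else 0) w.1))) : GL (Fin 2) (w.1.adicCompletion L))) : Matrix (Fin 2) (Fin 2) (w.1.adicCompletion L)) - 1) i j) ≤ Valued.v ((ϖ : (w.1.adicCompletion L)) ^ 2))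
    {n : ℕ} (hN : Valued.v ((((((localNonsplitEquiv (IsCMField.complexConj L) (Matrix.of fun i j : Fin 2 => if i.val + j.val + 1 = 2 then (1 : L) else 0) (IsCMField.complexConj_ne_one L) w hw) (γ₂) : ↥(unitaryGroupOfForm (galAdicCompletionMap (L := L) (IsCMField.complexConj L) hw) (placeForm (Matrix.of fun i j : Fin 2 => if i.val + j.val + 1 = 2 then (1 : L) else 0) w.1))) : GL (Fin 2) (w.1.adicCompletion L))) : Matrix (Fin 2) (Fin 2) (w.1.adicCompletion L)).trace ^ 2 - 4 * (((((localNonsplitEquiv (IsCMField.complexConj L) (Matrix.of fun i j : Fin 2 => if i.val + j.val + 1 = 2 then (1 : L) else 0) (IsCMField.complexConj_ne_one L) w hw) (γ₂) : ↥(unitaryGroupOfForm (galAdicCompletionMap (L := L) (IsCMField.complexConj L) hw) (placeForm (Matrix.of fun i j : Fin 2 => if i.val + j.val + 1 = 2 then (1 : L) else 0) w.1))) : GL (Fin 2) (w.1.adicCompletion L))) : Matrix (Fin 2) (Fin 2) (w.1.adicCompletion L)).det) = WithZero.exp (-((2 * (2 * n + 1) : ℕ) : ℤ))) :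
    ∃ k : GL (Fin 2) (w.1.adicCompletion L), k ∈ unitaryGroupOfForm (galAdicCompletionMap (L := L) (IsCMField.complexConj L) hw) (placeForm (Matrix.of fun i j : Fin 2 => if i.val + j.val + 1 = 2 then (1 : L) else 0) w.1) ∧
      (∀ a b : Fin 2, Valued.v ((((k⁻¹ * ((((localNonsplitEquiv (IsCMField.complexConj L) (Matrix.of fun i j : Fin 2 => if i.val + j.val + 1 = 2 then (1 : L) else 0) (IsCMField.complexConj_ne_one L) w hw) (γ₂) : ↥(unitaryGroupOfForm (galAdicCompletionMap (L := L) (IsCMField.complexConj L) hw) (placeForm (Matrix.of fun i j : Fin 2 => if i.val + j.val + 1 = 2 then (1 : L) else 0) w.1))) : GL (Fin 2) (w.1.adicCompletion L))) * k : GL (Fin 2) (w.1.adicCompletion L)) : Matrix (Fin 2) (Fin 2) (w.1.adicCompletion L)) - ((((((localNonsplitEquiv (IsCMField.complexConj L) (Matrix.of fun i j : Fin 2 => if i.val + j.val + 1 = 2 then (1 : L) else 0) (IsCMField.complexConj_ne_one L) w hw) (γ₂) : ↥(unitaryGroupOfForm (galAdicCompletionMap (L := L) (IsCMField.complexConj L)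 hw) (placeForm (Matrix.of fun i j : Fin 2 => if i.val + j.val + 1 = 2 then (1 : L) else 0) w.1))) : GL (Fin 2) (w.1.adicCompletion L))) : Matrix (Fin 2) (Fin 2) (w.1.adicCompletion L)).trace / 2) • (1 : Matrix (Fin 2) (Fin 2) (w.1.adicCompletion L))) a b) ≤ Valued.v ((ϖ : (w.1.adicCompletion L)) ^ (2 * n + 1))) ∧
      ¬ (∀ a b : Fin 2, Valued.v ((((k⁻¹ * ((((localNonsplitEquiv (IsCMField.complexConj L) (Matrix.of fun i j : Fin 2 => if i.val + j.val + 1 = 2 then (1 : L) else 0) (IsCMField.complexConj_ne_one L) w hw) (γ₂) : ↥(unitaryGroupOfForm (galAdicCompletionMap (L := L) (IsCMField.complexConj L) hw) (placeForm (Matrix.of fun i j : Fin 2 => if i.val + j.val + 1 = 2 then (1 : L) else 0) w.1))) : GL (Fin 2) (w.1.adicCompletion L))) * k : GL (Fin 2) (w.1.adicCompletion L)) : Matrix (Fin 2) (Fin 2) (w.1.adicCompletion L)) - ((((((localNonsplitEquiv (IsCMField.complexConj L) (Matrix.of fun i j : Fin 2 => if i.val + j.val + 1 = 2 then (1 : L)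 else 0) (IsCMField.complexConj_ne_one L) w hw) (γ₂) : ↥(unitaryGroupOfForm (galAdicCompletionMap (L := L) (IsCMField.complexConj L) hw) (placeForm (Matrix.of fun i j : Fin 2 => if i.val + j.val + 1 = 2 then (1 : L) else 0) w.1))) : GL (Fin 2) (w.1.adicCompletion L))) : Matrix (Fin 2) (Fin 2) (w.1.adicCompletion L)).trace / 2) • (1 : Matrix (Fin 2) (Fin 2) (w.1.adicCompletion L))) a b) ≤ Valued.v ((ϖ : (w.1.adicCompletion L)) ^ (2 * n + 2))) := by
  have hϖ0 : (ϖ : (w.1.adicCompletion L)) ≠ 0 := ϖ.ne_zero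
  have hvϖ0 : Valued.v (ϖ : (w.1.adicCompletion L)) ≠ 0 := (Valuation.ne_zero_iff _).2 hϖ0
  have h2w : Valued.v (2 : (w.1.adicCompletion L)) = 1 := (isUnit_two_integer_iff_valued_eq_one L w.1).1 h2
  have h20 : (2 : (w.1.adicCompletion L)) ≠ 0 := fun h0 => by rw [h0, map_zero] at h2w; exact zero_ne_one h2w
  have hΓU : ((((localNonsplitEquiv (IsCMField.complexConj L) (Matrix.of fun i j : Fin 2 => if i.val + j.val + 1 = 2 then (1 : L) else 0) (IsCMField.complexConj_ne_one L) w hw) (γ₂) : ↥(unitaryGroupOfForm (galAdicCompletionMap (L := L) (IsCMField.complexConj L) hw) (placeForm (Matrix.of fun i j : Fin 2 => if i.val + j.val + 1 = 2 then (1 : L) else 0) w.1))) : GL (Fin 2) (w.1.adicCompletion L))) ∈ unitaryGroupOfForm (galAdicCompletionMap (L := L) (IsCMField.complexConj L) hw) (placeForm (Matrix.of fun i j : Fin 2 => if i.val + j.val + 1 = 2 then (1 : L) else 0) w.1) := ((localNonsplitEquiv (IsCMField.complexConj L) (Matrix.of fun i j : Fin 2 => if i.val + j.val + 1 = 2 then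 (1 : L) else 0) (IsCMField.complexConj_ne_one L) w hw) (γ₂)).2
  -- the innermost ball `j = n` has ONE member: it is non-empty
  have hcard := ncard_selfDual_fixed_ball_of_odd_depth_ramified L v w hw he h2 ϖ hϖ hσϖ γ₂ hirr h2deep hN (j := n) le_rfl
  rw [show n - n + 1 = 1 by omega, Finset.sum_range_one, pow_zero, mul_one] at hcard
  have hne : ({B : Submodule (Valued.integer (w.1.adicCompletion L)) (Fin 2 → (w.1.adicCompletion L)) | UnitaryLatticeTree.IsSelfDualLattice (galAdicCompletionMap (L := L) (IsCMField.complexConj L) hw) (ϖ : (w.1.adicCompletion L)) (!![(0 : (w.1.adicCompletion L)), 1; 1, 0] : Matrix (Fin 2) (Fin 2) (w.1.adicCompletion L)) B ∧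
        UnitaryLatticeTree.mapGL ((((localNonsplitEquiv (IsCMField.complexConj L) (Matrix.of fun i j : Fin 2 => if i.val + j.val + 1 = 2 then (1 : L) else 0) (IsCMField.complexConj_ne_one L) w hw) (γ₂) : ↥(unitaryGroupOfForm (galAdicCompletionMap (L := L) (IsCMField.complexConj L) hw) (placeForm (Matrix.of fun i j : Fin 2 => if i.val + j.val + 1 = 2 then (1 : L) else 0) w.1))) : GL (Fin 2) (w.1.adicCompletion L))) B = B ∧
        B.map ((Matrix.toLin' ((((((localNonsplitEquiv (IsCMField.complexConj L) (Matrix.of fun i j : Fin 2 => if i.val + j.val + 1 = 2 then (1 : L) else 0) (IsCMField.complexConj_ne_one L) w hw) (γ₂) : ↥(unitaryGroupOfForm (galAdicCompletionMap (L := L) (IsCMField.complexConj L) hw) (placeForm (Matrix.of fun i j : Fin 2 => if i.val + j.val + 1 = 2 then (1 : L) else 0) w.1))) : GL (Fin 2) (w.1.adicCompletion L))) : Matrix (Fin 2) (Fin 2) (w.1.adicCompletion L)) - ((((((localNonsplitEquiv (IsCMField.complexConj L) (Matrix.of fun i j : Fin 2 => if i.val + j.val + 1 = 2 then (1 : L)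 else 0) (IsCMField.complexConj_ne_one L) w hw) (γ₂) : ↥(unitaryGroupOfForm (galAdicCompletionMap (L := L) (IsCMField.complexConj L) hw) (placeForm (Matrix.of fun i j : Fin 2 => if i.val + j.val + 1 = 2 then (1 : L) else 0) w.1))) : GL (Fin 2) (w.1.adicCompletion L))) : Matrix (Fin 2) (Fin 2) (w.1.adicCompletion L)).trace / 2) • (1 : Matrix (Fin 2) (Fin 2) (w.1.adicCompletion L)))).restrictScalars (Valued.integer (w.1.adicCompletion L))) ≤ UnitaryLatticeTree.scaleLattice ((ϖ : (w.1.adicCompletion L)) ^ (2 * n)) B}).ncard ≠ 0 := by omega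
  obtain ⟨B, hB⟩ := Set.nonempty_of_ncard_ne_zero hne
  -- odd-scale collapse: `B` is in the ball of scale `ϖ^(2n+1)`
  have hB' : B ∈ {B : Submodule (Valued.integer (w.1.adicCompletion L)) (Fin 2 → (w.1.adicCompletion L)) | UnitaryLatticeTree.IsSelfDualLattice (galAdicCompletionMap (L := L) (IsCMField.complexConj L) hw) (ϖ : (w.1.adicCompletion L)) (!![(0 : (w.1.adicCompletion L)), 1; 1, 0] : Matrix (Fin 2) (Fin 2) (w.1.adicCompletion L)) B ∧
        UnitaryLatticeTree.mapGL ((((localNonsplitEquiv (IsCMField.complexConj L) (Matrix.of fun i j : Fin 2 => if i.val + j.val + 1 = 2 then (1 : L) else 0) (IsCMField.complexConj_ne_one L) w hw) (γ₂) : ↥(unitaryGroupOfForm (galAdicCompletionMap (L := L) (IsCMField.complexConj L) hw) (placeForm (Matrix.of fun i j : Fin 2 => if i.val + j.val + 1 = 2 then (1 : L) else 0) w.1))) : GL (Fin 2) (w.1.adicCompletion L))) B = B ∧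
        B.map ((Matrix.toLin' ((((((localNonsplitEquiv (IsCMField.complexConj L) (Matrix.of fun i j : Fin 2 => if i.val + j.val + 1 = 2 then (1 : L) else 0) (IsCMField.complexConj_ne_one L) w hw) (γ₂) : ↥(unitaryGroupOfForm (galAdicCompletionMap (L := L) (IsCMField.complexConj L) hw) (placeForm (Matrix.of fun i j : Fin 2 => if i.val + j.val + 1 = 2 then (1 : L) else 0) w.1))) : GL (Fin 2) (w.1.adicCompletion L))) : Matrix (Fin 2) (Fin 2) (w.1.adicCompletion L)) - ((((((localNonsplitEquiv (IsCMField.complexConj L) (Matrix.of fun i j : Fin 2 => if i.val + j.val + 1 = 2 then (1 : L) else 0) (IsCMField.complexConj_ne_one L) w hw) (γ₂) : ↥(unitaryGroupOfForm (galAdicCompletionMap (L := L) (IsCMField.complexConj L) hw) (placeForm (Matrix.of fun i j : Fin 2 => if i.val + j.val + 1 = 2 then (1 : L) else 0) w.1))) : GL (Fin 2) (w.1.adicCompletion L))) : Matrix (Fin 2) (Fin 2) (w.1.adicCompletion L)).trace / 2) • (1 : Matrix (Fin 2) (Fin 2) (w.1.adicCompletion L)))).restrictScalars (Valued.integer (w.1.adicCompletion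 L))) ≤ UnitaryLatticeTree.scaleLattice ((ϖ : (w.1.adicCompletion L)) ^ (2 * n + 1)) B} := by
    rw [selfDual_fixed_ball_odd_scale_eq L v w hw he h2 ϖ hϖ hσϖ ((((localNonsplitEquiv (IsCMField.complexConj L) (Matrix.of fun i j : Fin 2 => if i.val + j.val + 1 = 2 then (1 : L) else 0) (IsCMField.complexConj_ne_one L) w hw) (γ₂) : ↥(unitaryGroupOfForm (galAdicCompletionMap (L := L) (IsCMField.complexConj L) hw) (placeForm (Matrix.of fun i j : Fin 2 => if i.val + j.val + 1 = 2 then (1 : L) else 0) w.1))) : GL (Fin 2) (w.1.adicCompletion L))) hΓU h2deep hN (j := n) (by omega)]; exact hB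
  obtain ⟨hsd, hfix, hle⟩ := hB'
  obtain ⟨u, hu⟩ := exists_unitary_mapGL_stdLattice_eq_of_isSelfDualLattice_two L v w hw he h2 B hsd
  rw [hu, map_toLin'_mapGL_stdLattice_le_scaleLattice_iff (pow_ne_zero _ hϖ0), conj_sub_smul_one_eq] at hle
  refine ⟨(u : GL (Fin 2) (w.1.adicCompletion L)), ?_, hle, fun hall => ?_⟩
  · rw [unitaryGroupOfForm_placeForm_antidiagTwo_eq]; exact u.2
  · -- `E_k² = ¼disc·1` with `|¼disc| = |ϖ|^(2N)`: the `(0,0)` entry cannot be `≤ |ϖ|^(2N+2)`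
    set E : Matrix (Fin 2) (Fin 2) (w.1.adicCompletion L) := ((((u : GL (Fin 2) (w.1.adicCompletion L))⁻¹ * ((((localNonsplitEquiv (IsCMField.complexConj L) (Matrix.of fun i j : Fin 2 => if i.val + j.val + 1 = 2 then (1 : L) else 0) (IsCMField.complexConj_ne_one L) w hw) (γ₂) : ↥(unitaryGroupOfForm (galAdicCompletionMap (L := L) (IsCMField.complexConj L) hw) (placeForm (Matrix.of fun i j : Fin 2 => if i.val + j.val + 1 = 2 then (1 : L) else 0) w.1))) : GL (Fin 2) (w.1.adicCompletion L))) * (u : GL (Fin 2) (w.1.adicCompletion L)) : GL (Fin 2) (w.1.adicCompletion L)) : Matrix (Fin 2) (Fin 2) (w.1.adicCompletion L)) - ((((((localNonsplitEquiv (IsCMField.complexConj L) (Matrix.of fun i j : Fin 2 => if i.val + j.val + 1 = 2 then (1 : L) else 0) (IsCMField.complexConj_ne_one L) w hw) (γ₂) : ↥(unitaryGroupOfForm (galAdicCompletionMap (L := L) (IsCMField.complexConj L) hw) (placeForm (Matrix.of fun i j : Fin 2 => if i.val + j.val + 1 = 2 then (1 : L) else 0) w.1))) : GL (Fin 2) (w.1.adicCompletion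 L))) : Matrix (Fin 2) (Fin 2) (w.1.adicCompletion L)).trace / 2) • (1 : Matrix (Fin 2) (Fin 2) (w.1.adicCompletion L))) with hE
    have htr : (((u : GL (Fin 2) (w.1.adicCompletion L))⁻¹ * ((((localNonsplitEquiv (IsCMField.complexConj L) (Matrix.of fun i j : Fin 2 => if i.val + j.val + 1 = 2 then (1 : L) else 0) (IsCMField.complexConj_ne_one L) w hw) (γ₂) : ↥(unitaryGroupOfForm (galAdicCompletionMap (L := L) (IsCMField.complexConj L) hw) (placeForm (Matrix.of fun i j : Fin 2 => if i.val + j.val + 1 = 2 then (1 : L) else 0) w.1))) : GL (Fin 2) (w.1.adicCompletion L))) * (u : GL (Fin 2) (w.1.adicCompletion L)) : GL (Fin 2) (w.1.adicCompletion L)) : Matrix (Fin 2) (Fin 2) (w.1.adicCompletion L)).trace = (((((localNonsplitEquiv (IsCMField.complexConj L) (Matrix.of fun i j : Fin 2 => if i.val + j.val + 1 = 2 then (1 : L) else 0) (IsCMField.complexConj_ne_one L) w hw) (γ₂) : ↥(unitaryGroupOfForm (galAdicCompletionMap (L := L) (IsCMField.complexConj L) hw) (placeForm (Matrix.of fun i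 j : Fin 2 => if i.val + j.val + 1 = 2 then (1 : L) else 0) w.1))) : GL (Fin 2) (w.1.adicCompletion L))) : Matrix (Fin 2) (Fin 2) (w.1.adicCompletion L)).trace := by
      rw [Units.val_mul, Units.val_mul, Matrix.trace_units_conj']
    have hdet : (((u : GL (Fin 2) (w.1.adicCompletion L))⁻¹ * ((((localNonsplitEquiv (IsCMField.complexConj L) (Matrix.of fun i j : Fin 2 => if i.val + j.val + 1 = 2 then (1 : L) else 0) (IsCMField.complexConj_ne_one L) w hw) (γ₂) : ↥(unitaryGroupOfForm (galAdicCompletionMap (L := L) (IsCMField.complexConj L) hw) (placeForm (Matrix.of fun i j : Fin 2 => if i.val + j.val + 1 = 2 then (1 : L) else 0) w.1))) : GL (Fin 2) (w.1.adicCompletion L))) * (u : GL (Fin 2) (w.1.adicCompletion L)) : GL (Fin 2) (w.1.adicCompletion L)) : Matrix (Fin 2) (Fin 2) (w.1.adicCompletion L)).det = (((((localNonsplitEquiv (IsCMField.complexConj L) (Matrix.of fun i j : Fin 2 => if i.val + j.val + 1 = 2 then (1 : L) else 0) (IsCMField.complexConj_ne_one L) w hw) (γ₂) : ↥(unitaryGroupOfForm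 (galAdicCompletionMap (L := L) (IsCMField.complexConj L) hw) (placeForm (Matrix.of fun i j : Fin 2 => if i.val + j.val + 1 = 2 then (1 : L) else 0) w.1))) : GL (Fin 2) (w.1.adicCompletion L))) : Matrix (Fin 2) (Fin 2) (w.1.adicCompletion L)).det := by
      rw [Units.val_mul, Units.val_mul, Matrix.det_units_conj']
    have hsq : E * E = (((((((localNonsplitEquiv (IsCMField.complexConj L) (Matrix.of fun i j : Fin 2 => if i.val + j.val + 1 = 2 then (1 : L) else 0) (IsCMField.complexConj_ne_one L) w hw) (γ₂) : ↥(unitaryGroupOfForm (galAdicCompletionMap (L := L) (IsCMField.complexConj L) hw) (placeForm (Matrix.of fun i j : Fin 2 => if i.val + j.val + 1 = 2 then (1 : L) else 0) w.1))) : GL (Fin 2) (w.1.adicCompletion L))) : Matrix (Fin 2) (Fin 2) (w.1.adicCompletion L)).trace / 2) ^ 2 - (((((localNonsplitEquiv (IsCMField.complexConj L) (Matrix.of fun i j : Fin 2 => if i.val + j.val + 1 = 2 then (1 : L) else 0) (IsCMField.complexConj_ne_one L) w hw) (γ₂) : ↥(unitaryGroupOfForm (galAdicCompletionMap (L := L)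 (IsCMField.complexConj L) hw) (placeForm (Matrix.of fun i j : Fin 2 => if i.val + j.val + 1 = 2 then (1 : L) else 0) w.1))) : GL (Fin 2) (w.1.adicCompletion L))) : Matrix (Fin 2) (Fin 2) (w.1.adicCompletion L)).det) • (1 : Matrix (Fin 2) (Fin 2) (w.1.adicCompletion L)) := by
      have h := sq_sub_half_trace_smul_one h20 (((u : GL (Fin 2) (w.1.adicCompletion L))⁻¹ * ((((localNonsplitEquiv (IsCMField.complexConj L) (Matrix.of fun i j : Fin 2 => if i.val + j.val + 1 = 2 then (1 : L) else 0) (IsCMField.complexConj_ne_one L) w hw) (γ₂) : ↥(unitaryGroupOfForm (galAdicCompletionMap (L := L) (IsCMField.complexConj L) hw) (placeForm (Matrix.of fun i j : Fin 2 => if i.val + j.val + 1 = 2 then (1 : L) else 0) w.1))) : GL (Fin 2) (w.1.adicCompletion L))) * (u : GL (Fin 2) (w.1.adicCompletion L)) : GL (Fin 2) (w.1.adicCompletion L)) : Matrix (Fin 2) (Fin 2) (w.1.adicCompletion L))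
      rw [htr, hdet] at h
      exact h
    have h00 : E 0 0 * E 0 0 + E 0 1 * E 1 0 = ((((((localNonsplitEquiv (IsCMField.complexConj L) (Matrix.of fun i j : Fin 2 => if i.val + j.val + 1 = 2 then (1 : L) else 0) (IsCMField.complexConj_ne_one L) w hw) (γ₂) : ↥(unitaryGroupOfForm (galAdicCompletionMap (L := L) (IsCMField.complexConj L) hw) (placeForm (Matrix.of fun i j : Fin 2 => if i.val + j.val + 1 = 2 then (1 : L) else 0) w.1))) : GL (Fin 2) (w.1.adicCompletion L))) : Matrix (Fin 2) (Fin 2) (w.1.adicCompletion L)).trace / 2) ^ 2 - (((((localNonsplitEquiv (IsCMField.complexConj L) (Matrix.of fun i j : Fin 2 => if i.val + j.val + 1 = 2 then (1 : L) else 0) (IsCMField.complexConj_ne_one L) w hw) (γ₂) : ↥(unitaryGroupOfForm (galAdicCompletionMap (L := L) (IsCMField.complexConj L) hw) (placeForm (Matrix.of fun i j : Fin 2 => if i.val + j.val + 1 = 2 then (1 : L) else 0) w.1))) : GL (Fin 2) (w.1.adicCompletion L))) : Matrix (Fin 2) (Fin 2) (w.1.adicCompletion L)).det := by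
      have h := congrFun (congrFun hsq 0) 0
      simpa [Matrix.mul_apply, Fin.sum_univ_two] using h
    -- valuation of the right-hand side: `|¼(tr² − 4det)| = exp(−2N)`
    have hrhs : Valued.v (((((((localNonsplitEquiv (IsCMField.complexConj L) (Matrix.of fun i j : Fin 2 => if i.val + j.val + 1 = 2 then (1 : L) else 0) (IsCMField.complexConj_ne_one L) w hw) (γ₂) : ↥(unitaryGroupOfForm (galAdicCompletionMap (L := L) (IsCMField.complexConj L) hw) (placeForm (Matrix.of fun i j : Fin 2 => if i.val + j.val + 1 = 2 then (1 : L) else 0) w.1))) : GL (Fin 2) (w.1.adicCompletion L))) : Matrix (Fin 2) (Fin 2) (w.1.adicCompletion L)).trace / 2) ^ 2 - (((((localNonsplitEquiv (IsCMField.complexConj L) (Matrix.of fun i j : Fin 2 => if i.val + j.val + 1 = 2 then (1 : L) else 0) (IsCMField.complexConj_ne_one L) w hw) (γ₂) : ↥(unitaryGroupOfForm (galAdicCompletionMap (L := L) (IsCMField.complexConj L) hw) (placeForm (Matrix.of fun i j : Fin 2 => if i.val + j.val + 1 = 2 then (1 : L) else 0) w.1))) : GL (Fin 2) (w.1.adicCompletion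 L))) : Matrix (Fin 2) (Fin 2) (w.1.adicCompletion L)).det) = WithZero.exp (-((2 * (2 * n + 1) : ℕ) : ℤ)) := by
      have e : ((((((localNonsplitEquiv (IsCMField.complexConj L) (Matrix.of fun i j : Fin 2 => if i.val + j.val + 1 = 2 then (1 : L) else 0) (IsCMField.complexConj_ne_one L) w hw) (γ₂) : ↥(unitaryGroupOfForm (galAdicCompletionMap (L := L) (IsCMField.complexConj L) hw) (placeForm (Matrix.of fun i j : Fin 2 => if i.val + j.val + 1 = 2 then (1 : L) else 0) w.1))) : GL (Fin 2) (w.1.adicCompletion L))) : Matrix (Fin 2) (Fin 2) (w.1.adicCompletion L)).trace / 2) ^ 2 - (((((localNonsplitEquiv (IsCMField.complexConj L) (Matrix.of fun i j : Fin 2 => if i.val + j.val + 1 = 2 then (1 : L) else 0) (IsCMField.complexConj_ne_one L) w hw) (γ₂) : ↥(unitaryGroupOfForm (galAdicCompletionMap (L := L) (IsCMField.complexConj L) hw) (placeForm (Matrix.of fun i j : Fin 2 => if i.val + j.val + 1 = 2 then (1 : L) else 0) w.1))) : GL (Fin 2) (w.1.adicCompletion L))) : Matrix (Fin 2) (Fin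 2) (w.1.adicCompletion L)).det = ((((((localNonsplitEquiv (IsCMField.complexConj L) (Matrix.of fun i j : Fin 2 => if i.val + j.val + 1 = 2 then (1 : L) else 0) (IsCMField.complexConj_ne_one L) w hw) (γ₂) : ↥(unitaryGroupOfForm (galAdicCompletionMap (L := L) (IsCMField.complexConj L) hw) (placeForm (Matrix.of fun i j : Fin 2 => if i.val + j.val + 1 = 2 then (1 : L) else 0) w.1))) : GL (Fin 2) (w.1.adicCompletion L))) : Matrix (Fin 2) (Fin 2) (w.1.adicCompletion L)).trace ^ 2 - 4 * (((((localNonsplitEquiv (IsCMField.complexConj L) (Matrix.of fun i j : Fin 2 => if i.val + j.val + 1 = 2 then (1 : L) else 0) (IsCMField.complexConj_ne_one L) w hw) (γ₂) : ↥(unitaryGroupOfForm (galAdicCompletionMap (L := L) (IsCMField.complexConj L) hw) (placeForm (Matrix.of fun i j : Fin 2 => if i.val + j.val + 1 = 2 then (1 : L) else 0) w.1))) : GL (Fin 2) (w.1.adicCompletion L))) : Matrix (Fin 2) (Fin 2) (w.1.adicCompletion L)).det) / 4 := by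
        field_simp
        ring
      rw [e, map_div₀, hN, show (4 : (w.1.adicCompletion L)) = 2 * 2 by norm_num, map_mul, h2w, mul_one, div_one]
    have hpow : ∀ k : ℕ, Valued.v (ϖ : (w.1.adicCompletion L)) ^ k = WithZero.exp (-(k : ℤ)) := by
      intro k
      induction k with
      | zero => simp
      | succ k ih =>
        rw [pow_succ, ih, hϖ, ← WithZero.exp_add]
        congr 1
        push_cast
        ring
    -- valuation of the left-hand side: each product of two entries is `≤ |ϖ|^(2n+2)·|ϖ|^(2n+2)`
    have hlhs : Valued.v (E 0 0 * E 0 0 + E 0 1 * E 1 0) ≤ Valued.v (ϖ : (w.1.adicCompletion L)) ^ (2 * n + 2) * Valued.v (ϖ : (w.1.adicCompletion L)) ^ (2 * n + 2) := by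
      refine (Valuation.map_add _ _ _).trans (max_le ?_ ?_) <;> rw [map_mul] <;>
        refine mul_le_mul' ?_ ?_ <;> rw [← map_pow] <;> exact hall _ _
    rw [h00, hrhs, hpow, ← WithZero.exp_add, WithZero.exp_le_exp] at hlhs
    push_cast at hlhs
    omega

end Centre

end Literature.NumberTheory.Automorphic.UnitaryGroup

end
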